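import Summits.ABC.StewartYu.PadicW80Par3E
import Summits.ABC.StewartYu.PadicW80SizesL
import Literature.NumberTheory.Transcendental.PadicCW77Functions
import HarnessLib

/-!
# The `q = 3` (`p = 2`) parameter record — the archimedean sizes, I: record-side (frame-free) bounds in the
# fine unit `𝔔 = exp(𝔘/1024)`

Support file (theorems only; no named facts), cell `abc-stewartyu` (p1; crux `W80Two` stmt-ABC-19486; design memo
HOME/p1/S2-q3-record-design.md).  Base-`3` twin of the record half of `PadicW80SizesL`/`PadicW80ParLPM`:
the largest `Δ`-argument `X = 3^{d+2} L_θ S₀ ≤ 33U/(c_L' m V_θ)` and `log((X+h)/h) ≤ 6G`; the moderate powers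
`T^T, 3^{J₀}^{T}, 2^{hL_b}, (e(x+h)/h)^{hL_b}, ν(h)ᵏ (Waldschmidt's lcm) ≤ 𝔔 or 𝔔²`, `ν(x,h)ᵏ ≤ 𝔔¹⁵` (Baker's
`nuBound`), the number of unknowns `h L_b ∏(Lall3ᵢ/3ᴶ + 1) ≤ 𝔔`, `|x|ᵏ ≤ 𝔔` for `|x| ≤ e^W`, `k ≤ T`, the
height sums `∑ eᵢ Vallᵢ ≤ c𝔘/(3c_L')` for `eᵢ ≤ c·Lall3ᵢ·S₀`, and **the `Δ`-value factor of p2-g3's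
`qΔ3 = DwQ (3^{J₀−J}) a b h τ₀ s`**: `|DwQ c a b h k s| ≤ k!·cᵏ·2^{a+bh}·(e(cs+h)/h)^{h(b+1)}` (generic `c`, from
`Waldschmidt1980.norm_pv_le`) and `|DwQ (3^{J₀−J}) a b h τ₀ s| ≤ 𝔔⁴` for `a < h`, `b < L_b`, `τ₀ ≤ T`,
`J ≤ J₀`, `s ≤ 3^{d+1+J} S₀`.  Everything is [folklore] bookkeeping on
[cite: Waldschmidt1980, §3.2–3.4 (3.13)–(3.22) (pp. 265–270)].
-/

noncomputable section

open Finset Real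
open Literature.NumberTheory.Transcendental
open Literature.NumberTheory.Transcendental.Baker1975
open Literature.NumberTheory.Transcendental.Baker1975.Ch3
open Literature.NumberTheory.Transcendental.CW77

namespace Summit.ABC.StewartYu

open PadicW80Par (cTp cSp cLp cLp' Ap mRp)

namespace PadicW80ParL

variable {d : ℕ} (P : PadicW80ParL d)

/-! ### The largest `Δ`-argument -/

/-- `0 ≤ X`. [folklore] -/
theorem Xpt3_nonneg : 0 ≤ P.Xpt3 := by unfold Xpt3; positivity

/-- `X ≤ 33 U/(c_L' m V_θ)` (indeed `X = 3^{d+2} L_θ S₀ ≤ U/(c_L' m V_θ)`). [folklore] -/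
theorem Xpt3_le : P.Xpt3 ≤ 33 * P.Uℓ / (cLp' * mRp d * P.Vθ) := by
  have hL := P.Lθ3_le
  have hS := P.S₀3_pos; have hV := P.hVθ1; have hm := mR_pos P; have hU := P.U_pos
  unfold Xpt3 cLp' at *
  rw [le_div_iff₀ (by positivity)] at hL
  rw [le_div_iff₀ (by positivity)]
  have h3 : (0 : ℝ) < 3 ^ (d + 2) := by positivity
  nlinarith [mul_le_mul_of_nonneg_left hL h3.le]

/-- **`X/h + 1 ≤ e^{6G}`** (`X/h ≤ X G/W⋆ ≤ 2⁻⁷ Mcl Aᵐ m^{2m+3} (∏Vⱼ) G² ≤ 2⁻⁷ e^{6G}`). [folklore] -/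
theorem Xpt3_div_hpar_le_six : P.Xpt3 / P.hparℓ + 1 ≤ Real.exp (6 * P.Gℓ) := by
  have hh := P.hpar_pos; have hG := P.G_pos; have hW := P.one_le_Wstar; have hm := two_le_mR P
  have hm0 := mR_pos P; have hVf := P.hVmax1; have hVθ := P.hVθ1; have hV1 := P.one_le_prodVs
  have hM := P.hMcl
  have h1 : P.Xpt3 / P.hparℓ ≤ P.Xpt3 * P.Gℓ / P.Wstarℓ := by
    rw [div_le_div_iff₀ hh (by linarith)]
    have := P.Wstar_div_G_lt_hpar
    rw [div_lt_iff₀ hG] at this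
    have hX := P.Xpt3_nonneg
    nlinarith
  set Z : ℝ := P.Mcl * (Ap ^ (d + 1) * mRp d ^ (2 * d + 3) * (∏ j, P.V j) * P.Gℓ ^ 2) with hZdef
  have hZ0 : 0 ≤ Z := by rw [hZdef]; unfold Ap; positivity
  have h2 : P.Xpt3 * P.Gℓ / P.Wstarℓ ≤ 33 / (2 ^ 12 * mRp d) * Z := by
    have hX := P.Xpt3_le
    rw [div_le_iff₀ (by linarith)]
    have hfac : (1 : ℝ) ≤ (d + 1).factorial := by exact_mod_cast Nat.one_le_iff_ne_zero.mpr (Nat.factorial_ne_zero _)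
    have hUeq : P.Uℓ = P.Mcl * Ap ^ (d + 1) * (mRp d ^ (2 * d + 3) / (d + 1).factorial) * ((∏ j, P.nV j) * P.nVθ) *
        P.Wstarℓ * P.nGℓ := rfl
    unfold cLp' at hX
    rw [le_div_iff₀ (by positivity)] at hX
    have hA : (0 : ℝ) ≤ Ap ^ (d + 1) := by unfold Ap; positivity
    have hprod : (∏ j, P.nV j) ≤ ∏ j, P.V j :=
      prod_le_prod (fun j _ => le_trans zero_le_one (P.one_le_nV j)) fun j _ => P.nV_le j
    have hnVθ : P.nVθ ≤ P.Vθ := P.nVθ_le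
    have hnG : P.nGℓ ≤ P.Gℓ := by unfold nGℓ; exact div_le_self hG.le P.hℓ
    have hnV0 : 0 ≤ ∏ j, P.nV j := le_trans zero_le_one P.one_le_prodnV
    have hnVθ0 : 0 ≤ P.nVθ := le_trans zero_le_one P.one_le_nVθ
    have hnG0 : 0 ≤ P.nGℓ := P.nG_pos.le
    have key : P.Xpt3 * (2 ^ 12 * mRp d * P.Vθ) * P.Gℓ ≤ 33 * (Z * P.Wstarℓ * P.Vθ) := by
      have hdiv : mRp d ^ (2 * d + 3) / (d + 1).factorial ≤ mRp d ^ (2 * d + 3) := div_le_self (by positivity) hfac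
      calc P.Xpt3 * (2 ^ 12 * mRp d * P.Vθ) * P.Gℓ ≤ 33 * P.Uℓ * P.Gℓ := by nlinarith
        _ = 33 * (P.Mcl * (Ap ^ (d + 1) * (mRp d ^ (2 * d + 3) / (d + 1).factorial) * (∏ j, P.nV j) *
              (P.nGℓ * P.Gℓ)) * P.Wstarℓ * P.nVθ) := by rw [hUeq]; ring
        _ ≤ 33 * (P.Mcl * (Ap ^ (d + 1) * mRp d ^ (2 * d + 3) * (∏ j, P.V j) * (P.Gℓ * P.Gℓ)) * P.Wstarℓ * P.Vθ) := by
            gcongr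
        _ = 33 * (Z * P.Wstarℓ * P.Vθ) := by rw [hZdef]; ring
    have hden : (0 : ℝ) < 2 ^ 12 * mRp d * P.Vθ := by positivity
    have : P.Xpt3 * P.Gℓ ≤ 33 / (2 ^ 12 * mRp d) * Z * P.Wstarℓ := by
      rw [show 33 / (2 ^ 12 * mRp d) * Z * P.Wstarℓ = 33 * (Z * P.Wstarℓ * P.Vθ) / (2 ^ 12 * mRp d * P.Vθ) by
        field_simp]
      rw [le_div_iff₀ hden]
      calc P.Xpt3 * P.Gℓ * (2 ^ 12 * mRp d * P.Vθ) = P.Xpt3 * (2 ^ 12 * mRp d * P.Vθ) * P.Gℓ := by ring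
        _ ≤ 33 * (Z * P.Wstarℓ * P.Vθ) := key
    linarith
  have f1 := P.A_pow_mul_le
  have f3 := P.prodV_le_exp_G
  have f4 := P.G_sq_le_exp_G
  have f0 : P.Mcl ≤ Real.exp P.Gℓ := by
    have h1 : Real.log P.Mcl ≤ P.Gℓ := P.hMclℓ.trans P.ℓ_le_G
    calc P.Mcl = Real.exp (Real.log P.Mcl) := (Real.exp_log (by linarith)).symm
      _ ≤ Real.exp P.Gℓ := Real.exp_le_exp.mpr h1
  have h3 : Z ≤ Real.exp (6 * P.Gℓ) := by
    rw [hZdef]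
    calc P.Mcl * (Ap ^ (d + 1) * mRp d ^ (2 * d + 3) * (∏ j, P.V j) * P.Gℓ ^ 2)
        = P.Mcl * ((Ap ^ (d + 1) * mRp d ^ (2 * d + 3)) * (∏ j, P.V j) * P.Gℓ ^ 2) := by ring
      _ ≤ Real.exp P.Gℓ * (Real.exp (3 * P.Gℓ) * Real.exp P.Gℓ * Real.exp P.Gℓ) := by
          have : (0 : ℝ) ≤ Ap ^ (d + 1) * mRp d ^ (2 * d + 3) := by unfold Ap; positivity
          gcongr
      _ = Real.exp (6 * P.Gℓ) := by simp only [← Real.exp_add]; ring_nf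
  have hc : 33 / (2 ^ 12 * mRp d) ≤ (1 : ℝ) / 2 ^ 7 := by
    rw [div_le_div_iff₀ (by positivity) (by norm_num)]; nlinarith
  have hE1 : (2 : ℝ) ≤ Real.exp (6 * P.Gℓ) := by
    have := Real.add_one_le_exp (6 * P.Gℓ); have := P.one_le_G; linarith
  have h4 : 33 / (2 ^ 12 * mRp d) * Z + 1 ≤ Real.exp (6 * P.Gℓ) := by
    have : 33 / (2 ^ 12 * mRp d) * Z ≤ (1 : ℝ) / 2 ^ 7 * Real.exp (6 * P.Gℓ) :=
      mul_le_mul hc h3 hZ0 (by norm_num)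
    linarith
  linarith [h1, h2, h4]

/-- **`log((X + h)/h) ≤ 6 G`.** [cite: Waldschmidt1980, (3.13)–(3.14) (p. 265)] -/
theorem log_Xpt3_div_le_six : Real.log ((P.Xpt3 + P.hparℓ) / P.hparℓ) ≤ 6 * P.Gℓ := by
  have hh := P.hpar_pos
  have e : (P.Xpt3 + P.hparℓ) / P.hparℓ = P.Xpt3 / P.hparℓ + 1 := by field_simp
  rw [e]
  have h := P.Xpt3_div_hpar_le_six
  have hpos : 0 < P.Xpt3 / P.hparℓ + 1 := by have := P.Xpt3_nonneg; positivity
  calc Real.log (P.Xpt3 / P.hparℓ + 1) ≤ Real.log (Real.exp (6 * P.Gℓ)) := Real.log_le_log hpos h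
    _ = 6 * P.Gℓ := Real.log_exp _

/-! ### Moderate powers in the fine unit -/

/-- **`T^T ≤ 𝔔`** (`T log T ≤ 10·T·W⋆ ≤ 10𝔘/c_T`). [folklore] -/
theorem T3_pow_T3_le_𝔔3 : (P.T3 : ℝ) ^ P.T3 ≤ P.𝔔3 := by
  have hT := P.T3_pos
  refine P.le_𝔔3_of_log_le ?_
  rw [Real.log_pow]
  have hTU : (P.T3 : ℝ) ≤ P.Uℓ := by
    have h1 := P.T3_le_𝔘3; have h2 : P.𝔘3 ≤ P.Uℓ := by
      rw [P.U_eq3]; have : (1 : ℝ) ≤ 3 ^ (d + 1) := one_le_pow₀ (by norm_num)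
      nlinarith [P.𝔘3_pos]
    have h3 : P.𝔘3 / cTp ≤ P.𝔘3 := div_le_self P.𝔘3_pos.le (by unfold cTp; norm_num)
    linarith
  have h1 : Real.log P.T3 ≤ 10 * P.Wstarℓ := (Real.log_le_log hT hTU).trans P.log_U_le
  have h2 := P.T3Wstar_le; have hU := P.𝔘3_pos
  calc (P.T3 : ℝ) * Real.log P.T3 ≤ P.T3 * (10 * P.Wstarℓ) := mul_le_mul_of_nonneg_left h1 hT.le
    _ = 10 * (P.T3 * P.Wstarℓ) := by ring
    _ ≤ 10 * (P.𝔘3 / cTp) := by gcongr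
    _ ≤ P.𝔘3 / 1024 := by unfold cTp; nlinarith

/-- `y^k ≤ 𝔔` for `1 ≤ y ≤ T`, `k ≤ T`. [folklore] -/
theorem pow_le_𝔔3_of_le_T3 {y : ℝ} (hy1 : 1 ≤ y) (hyT : y ≤ P.T3) {k : ℕ} (hk : k ≤ P.T3) : y ^ k ≤ P.𝔔3 := by
  calc y ^ k ≤ y ^ P.T3 := pow_le_pow_right₀ hy1 hk
    _ ≤ (P.T3 : ℝ) ^ P.T3 := pow_le_pow_left₀ (by linarith) hyT _
    _ ≤ P.𝔔3 := P.T3_pow_T3_le_𝔔3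

/-- `T^k ≤ 𝔔` for `k ≤ T`. [folklore] -/
theorem T3_pow_le_𝔔3 {k : ℕ} (hk : k ≤ P.T3) : (P.T3 : ℝ) ^ k ≤ P.𝔔3 :=
  P.pow_le_𝔔3_of_le_T3 (by exact_mod_cast P.one_le_T3) le_rfl hk

/-- `k! ≤ 𝔔` for `k ≤ T`. [folklore] -/
theorem factorial_le_𝔔3 {k : ℕ} (hk : k ≤ P.T3) : (k.factorial : ℝ) ≤ P.𝔔3 := by
  have h2 : (k.factorial : ℝ) ≤ (k : ℝ) ^ k := by exact_mod_cast Nat.factorial_le_pow k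
  have h3 : (k : ℝ) ^ k ≤ (P.T3 : ℝ) ^ k := pow_le_pow_left₀ (Nat.cast_nonneg _) (by exact_mod_cast hk) _
  exact h2.trans (h3.trans (P.T3_pow_le_𝔔3 hk))

/-- `3^{J₀} ≤ T` (`3^{J₀} ≤ 3 L_θ ≤ 2¹¹ m² nV_θ L_θ ≤ T`). [folklore] -/
theorem three_pow_J₀3_le_T3 : 3 ^ P.J₀3 ≤ P.T3 := by
  have h1 := P.three_pow_le
  have h2 := P.T3_ge_Lθ3
  have hm := two_le_mR P; have hV := P.one_le_nVθ
  have hL : (0 : ℝ) ≤ P.Lθ3 := Nat.cast_nonneg _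
  have : ((3 * P.Lθ3 : ℕ) : ℝ) ≤ P.T3 := by
    push_cast
    refine le_trans ?_ h2
    have : (3 : ℝ) ≤ 2 ^ 11 * mRp d ^ 2 * P.nVθ := by nlinarith
    nlinarith
  have h3 : 3 * P.Lθ3 ≤ P.T3 := by exact_mod_cast this
  omega

/-- The scale `3^{J₀−J}` is `≤ T`. [folklore] -/
theorem scale3_le_T3 (J : ℕ) : 3 ^ (P.J₀3 - J) ≤ P.T3 :=
  (Nat.pow_le_pow_right (by norm_num) (Nat.sub_le _ _)).trans P.three_pow_J₀3_le_T3

/-- The `Δ`-arguments are `≤ X`: `3^{J₀−J}·s ≤ X = 3^{d+2} L_θ S₀` for `J ≤ J₀`, `s ≤ 3^{d+1+J} S₀`. [folklore] -/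
theorem scale3_mul_le_Xpt3 {J s : ℕ} (hJ : J ≤ P.J₀3) (hs : s ≤ 3 ^ (d + 1 + J) * P.S₀3) :
    ((3 ^ (P.J₀3 - J) * s : ℕ) : ℝ) ≤ P.Xpt3 := by
  have h1 := P.three_pow_le
  have key : 3 ^ (P.J₀3 - J) * s ≤ 3 ^ (d + 2) * P.Lθ3 * P.S₀3 := by
    calc 3 ^ (P.J₀3 - J) * s ≤ 3 ^ (P.J₀3 - J) * (3 ^ (d + 1 + J) * P.S₀3) := Nat.mul_le_mul_left _ hs
      _ = 3 ^ (d + 1) * 3 ^ P.J₀3 * P.S₀3 := by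
          rw [show 3 ^ (P.J₀3 - J) * (3 ^ (d + 1 + J) * P.S₀3) = (3 ^ (P.J₀3 - J) * 3 ^ J) * 3 ^ (d + 1) * P.S₀3 by
            rw [pow_add]; ring, ← pow_add, Nat.sub_add_cancel hJ]; ring
      _ ≤ 3 ^ (d + 1) * (3 * P.Lθ3) * P.S₀3 := Nat.mul_le_mul_right _ (Nat.mul_le_mul_left _ h1)
      _ = 3 ^ (d + 2) * P.Lθ3 * P.S₀3 := by rw [pow_succ]; ring
  unfold Xpt3
  exact_mod_cast key

/-- **`2^{h L_b} ≤ 𝔔`.** [folklore] -/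
theorem two_pow_hLb3_le_𝔔3 : (2 : ℝ) ^ (P.hparℓ * P.Lb3) ≤ P.𝔔3 := by
  have h2 : (2 : ℝ) = Real.exp (Real.log 2) := (Real.exp_log two_pos).symm
  rw [h2, ← Real.exp_nat_mul]
  refine P.exp_le_𝔔3 ?_
  push_cast
  have h1 := P.hparLb3_le; have hW := P.Wstar_le_𝔘3; have hU := P.𝔘3_pos
  have hl2 : Real.log 2 ≤ 1 := by linarith [Real.log_two_lt_d9]
  have h0 : (0 : ℝ) ≤ P.hparℓ * P.Lb3 := by positivity
  calc ((P.hparℓ : ℝ) * P.Lb3) * Real.log 2 ≤ (P.hparℓ * P.Lb3) * 1 := mul_le_mul_of_nonneg_left hl2 h0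
    _ ≤ P.𝔘3 / cLp + 4 * P.Wstarℓ := by linarith
    _ ≤ P.𝔘3 / 1024 := by unfold cLp; nlinarith

/-- **`(e(x+h)/h)^{h L_b} ≤ 𝔔`** for `x ≤ X`. [cite: Waldschmidt1980, (3.13)–(3.14) (p. 265)] -/
theorem ratio3_pow_le_𝔔3 {x : ℝ} (hx0 : 0 ≤ x) (hx : x ≤ P.Xpt3) :
    (Real.exp 1 * (x + P.hparℓ) / P.hparℓ) ^ (P.hparℓ * P.Lb3) ≤ P.𝔔3 := by
  have hh := P.hpar_pos
  have hbase : 1 ≤ Real.exp 1 * (x + P.hparℓ) / P.hparℓ := by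
    rw [le_div_iff₀ hh]; have := Real.exp_one_gt_two; nlinarith
  have hpos : 0 < Real.exp 1 * (x + P.hparℓ) / P.hparℓ := by linarith
  refine P.le_𝔔3_of_log_le ?_
  rw [Real.log_pow]
  have h1 : Real.log (Real.exp 1 * (x + P.hparℓ) / P.hparℓ) = 1 + Real.log ((x + P.hparℓ) / P.hparℓ) := by
    rw [mul_div_assoc, Real.log_mul (Real.exp_pos 1).ne' (by positivity), Real.log_exp]
  rw [h1]
  have h2 : Real.log ((x + P.hparℓ) / P.hparℓ) ≤ 6 * P.Gℓ := by
    refine le_trans (Real.log_le_log (by positivity) ?_) P.log_Xpt3_div_le_six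
    exact div_le_div_of_nonneg_right (by linarith) hh.le
  have hG := P.one_le_G
  have h3 := P.hparLb3G_le; have hW := P.Wstar_le_𝔘3; have hGU := P.G_le_𝔘3; have hU := P.𝔘3_pos
  have h0 : (0 : ℝ) ≤ P.hparℓ * P.Lb3 := by positivity
  push_cast
  calc ((P.hparℓ : ℝ) * P.Lb3) * (1 + Real.log ((x + P.hparℓ) / P.hparℓ))
      ≤ (P.hparℓ * P.Lb3) * (7 * P.Gℓ) := mul_le_mul_of_nonneg_left (by linarith) h0
    _ = 7 * (P.hparℓ * P.Lb3 * P.Gℓ) := by ring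
    _ ≤ 7 * (P.𝔘3 / cLp + (P.Wstarℓ + P.Gℓ)) := by gcongr
    _ ≤ P.𝔘3 / 1024 := by unfold cLp; nlinarith

/-- **`ν(x, h)^k ≤ 𝔔¹⁵`** for `x ≤ X`, `k ≤ T` (Baker's point-dependent denominator `nuBound`;
`T·log ν ≤ 240·T·W⋆ ≤ 240𝔘/c_T = 15𝔘/1024`). [cite: Waldschmidt1980, §3.4 (3.21) (p. 269)] -/
theorem nuBound_pow_le_𝔔3 {x k : ℕ} (hx : (x : ℝ) ≤ P.Xpt3) (hk : k ≤ P.T3) :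
    ((nuBound x P.hparℓ : ℕ) : ℝ) ^ k ≤ P.𝔔3 ^ 15 := by
  have hν1 : (1 : ℝ) ≤ nuBound x P.hparℓ := by exact_mod_cast nuBound_pos x P.hparℓ
  refine (pow_le_pow_right₀ hν1 hk).trans (P.le_𝔔3_pow_of_log_le ?_)
  rw [Real.log_pow]
  have h1 := Waldschmidt1980.W80Par.log_nuBound_le_one_le (x := x) P.one_le_hpar
  have hh := P.hpar_pos
  have h2 : Real.log (((x : ℝ) + P.hparℓ) / P.hparℓ) ≤ 6 * P.Gℓ := by
    refine le_trans (Real.log_le_log (by positivity) ?_) P.log_Xpt3_div_le_six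
    exact div_le_div_of_nonneg_right (by linarith) hh.le
  have hG := P.one_le_G
  have h3 : Real.log (nuBound x P.hparℓ) ≤ P.hparℓ * (60 * P.Gℓ) := by
    refine h1.trans (mul_le_mul_of_nonneg_left ?_ hh.le)
    linarith
  have hT := P.T3_pos; have hTW := P.T3Wstar_le; have hGW := P.G_le_three_Wstar; have hhG := P.hparG_le
  have hU := P.𝔘3_pos
  push_cast
  calc (P.T3 : ℝ) * Real.log (nuBound x P.hparℓ) ≤ P.T3 * (P.hparℓ * (60 * P.Gℓ)) :=
        mul_le_mul_of_nonneg_left h3 hT.le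
    _ = 60 * P.T3 * (P.hparℓ * P.Gℓ) := by ring
    _ ≤ 60 * P.T3 * (P.Wstarℓ + P.Gℓ) := by gcongr
    _ ≤ 60 * P.T3 * (4 * P.Wstarℓ) := by gcongr; linarith
    _ = 240 * (P.T3 * P.Wstarℓ) := by ring
    _ ≤ 240 * (P.𝔘3 / cTp) := by gcongr
    _ = 15 * (P.𝔘3 / 1024) := by unfold cTp; ring

/-- `ν(h) ≤ e^{6h}` for Waldschmidt's point-free denominator `ν(h) = lcm(1,…,h)`, all `h` (`ν(0) = ν(1) = 1`).
[cite: Waldschmidt1980, Lemma 2.4 (p. 262)] -/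
theorem nu_le_exp_six (h : ℕ) : (Waldschmidt1980.nu h : ℝ) ≤ Real.exp (6 * h) := by
  rcases Nat.lt_or_ge h 2 with hlt | hge
  · have hnu : Waldschmidt1980.nu h = 1 := by
      unfold Waldschmidt1980.nu
      refine prod_eq_one fun p hp => ?_
      rw [Nat.mem_primesBelow] at hp
      have := hp.2.two_le
      omega
    rw [hnu]; push_cast
    exact Real.one_le_exp (by positivity)
  · exact Waldschmidt1980.nu_le_exp hge

/-- **`ν(h)^k ≤ 𝔔²`** for `k ≤ T` (`6 h k ≤ 18 T W⋆ ≤ 18𝔘/c_T ≤ 2𝔘/1024`): if the `q = 3` frame clears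
denominators with Waldschmidt's `ν(h)` the `Δ`-denominators are negligible. [cite: Waldschmidt1980, (3.18) (p. 266)] -/
theorem nu_pow_le_𝔔3 {k : ℕ} (hk : k ≤ P.T3) : ((Waldschmidt1980.nu P.hparℓ : ℕ) : ℝ) ^ k ≤ P.𝔔3 ^ 2 := by
  have hν1 : (1 : ℝ) ≤ Waldschmidt1980.nu P.hparℓ := by exact_mod_cast Waldschmidt1980.nu_pos P.hparℓ
  refine (pow_le_pow_right₀ hν1 hk).trans (P.le_𝔔3_pow_of_log_le ?_)
  rw [Real.log_pow]
  have h1 : Real.log (Waldschmidt1980.nu P.hparℓ) ≤ 6 * P.hparℓ := by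
    have := Real.log_le_log (by exact_mod_cast Waldschmidt1980.nu_pos P.hparℓ) (nu_le_exp_six P.hparℓ)
    rwa [Real.log_exp] at this
  have hh := P.hpar_le; have hT := P.T3_pos; have hTW := P.T3Wstar_le; have hU := P.𝔘3_pos
  push_cast
  calc (P.T3 : ℝ) * Real.log (Waldschmidt1980.nu P.hparℓ) ≤ P.T3 * (6 * P.hparℓ) := mul_le_mul_of_nonneg_left h1 hT.le
    _ ≤ P.T3 * (6 * (3 * P.Wstarℓ)) := by gcongr
    _ = 18 * (P.T3 * P.Wstarℓ) := by ring
    _ ≤ 18 * (P.𝔘3 / cTp) := by gcongr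
    _ ≤ 2 * (P.𝔘3 / 1024) := by unfold cTp; nlinarith

/-- `|y|^k ≤ 𝔔` for `|y| ≤ e^W`, `k ≤ T` (`k W ≤ T W⋆ ≤ 𝔘/c_T`): the coefficient powers `|b_θ|^k`. [folklore] -/
theorem pow_le_𝔔3_of_abs_le_exp {y : ℝ} (hy : |y| ≤ Real.exp P.W) {k : ℕ} (hk : k ≤ P.T3) : |y| ^ k ≤ P.𝔔3 := by
  have hW1 := P.hW
  have h1 : |y| ^ k ≤ Real.exp P.W ^ k := pow_le_pow_left₀ (abs_nonneg _) hy _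
  rw [← Real.exp_nat_mul] at h1
  refine h1.trans (P.exp_le_𝔔3 ?_)
  have hTW := P.T3Wstar_le; have hWs := P.W_le_Wstar; have hT := P.T3_pos; have hU := P.𝔘3_pos
  have hk' : (k : ℝ) ≤ P.T3 := by exact_mod_cast hk
  calc (k : ℝ) * P.W ≤ P.T3 * P.Wstarℓ := mul_le_mul hk' hWs (by linarith) hT.le
    _ ≤ P.𝔘3 / cTp := hTW
    _ ≤ P.𝔘3 / 1024 := by unfold cTp; rw [div_le_div_iff₀ (by norm_num) (by norm_num)]; nlinarith

end PadicW80ParL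

end Summit.ABC.StewartYu

end
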